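import Literature.Computability.AlgebraicComplexity.BorderRankMatMulThreeKernel
import Literature.Computability.AlgebraicComplexity.BorderRankMatMulThreeBlocks
import Literature.Computability.AlgebraicComplexity.BorderApolarityCandidates
import HarnessLib

/-!
# Borel-fixed `(110)`-candidates of `⟨3,3,3⟩`, VI: soundness of the kernel procedure, semantics

Topic `Literature/Computability/AlgebraicComplexity`. First half of the soundness proof of the
kernel test procedure `BorderRankMatMulThreeKernel.lean`: the MEANING over a field `K` (with the
free diagonal `(0, α, β)`) of its codes, and the facts the checker relies on.

* `MatMul3.codeA`, `codeB` — the codes `3i + k`, `3i' + j` of the coordinates `a = (i,k)`,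
  `b = (i',j)`; `MatMul3.Ker.LF.eval`, `MatMul3.Ker.MVec.toFun` — linear forms and model vectors as
  elements of `K` and of `K^{A ⊗ B}`;
* `MatMul3.Ker.colI/colK` — the column `(s₀, v)` of the `(210)`/`(120)` test IS the
  skew-symmetrisation of the array with one slice `v` (`colI_mem`: it lies in
  `skewIL (slicesI E)` when `v ∈ E`), and its entries ARE `entryI/entryK` (`colI_apply`);
* weights: a model vector is a weight vector of weight `MVec.wt` (`toFun_ne_zero`), so a column
  is supported on the rows of its weight `colWt` (`colI_ne_zero`, `colK_ne_zero`);
* `MatMul3.Ker.detL_eq_det` — the list Laplace expansion is the determinant.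

## References

* A. Conner, A. Harper, J. M. Landsberg, *New lower bounds for matrix multiplication and `det₃`*,
  Forum Math. Pi 11 (2023) e17, arXiv:1911.07981 — §3, §6. [ConnerHarperLandsberg2023]
-/

noncomputable section

open scoped BigOperators

namespace Literature.Computability.AlgebraicComplexity

namespace BorderApolarity

namespace MatMul3

universe u

/-! ## Codes of coordinates -/

/-- Code `3i + k` of `a = (i, k)`. [folklore] -/
def codeA (a : I9') : ℕ := 3 * (a.1 : ℕ) + (a.2 : ℕ)

/-- `codeA a / 3 = i`. [folklore] -/
theorem codeA_div (a : I9') : codeA a / 3 = (a.1 : ℕ) := by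
  have := a.2.isLt; simp only [codeA]; omega

/-- `codeA a % 3 = k`. [folklore] -/
theorem codeA_mod (a : I9') : codeA a % 3 = (a.2 : ℕ) := by
  have := a.2.isLt; simp only [codeA]; omega

/-- `codeA a < 9`. [folklore] -/
theorem codeA_lt (a : I9') : codeA a < 9 := by
  have := a.1.isLt; have := a.2.isLt; simp only [codeA]; omega

/-- `codeA` is injective. [folklore] -/
theorem codeA_injective : Function.Injective codeA := by
  intro a a' h
  have h1 := congrArg (· / 3) h
  have h2 := congrArg (· % 3) h
  simp only [codeA_div, codeA_mod] at h1 h2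
  exact Prod.ext (Fin.ext h1) (Fin.ext h2)

/-- Decoding a code `< 9`. [folklore] -/
def decode9 (n : ℕ) : I9' := (⟨n / 3 % 3, Nat.mod_lt _ (by decide)⟩, ⟨n % 3, Nat.mod_lt _ (by decide)⟩)

/-- `codeA (decode9 n) = n` for `n < 9`. [folklore] -/
theorem codeA_decode9 {n : ℕ} (hn : n < 9) : codeA (decode9 n) = n := by
  simp only [codeA, decode9]
  have : n / 3 < 3 := by omega
  rw [Nat.mod_eq_of_lt this]
  omega

/-- `decode9 (codeA a) = a`. [folklore] -/
theorem decode9_codeA (a : I9') : decode9 (codeA a) = a :=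
  codeA_injective (codeA_decode9 (codeA_lt a))

namespace Ker

variable {K : Type u} [Field K]

/-! ## Linear forms and model vectors over `K` -/

/-- Evaluation of a linear form at `(α, β)`. [folklore] -/
def LF.eval (α β : K) (x : LF) : K := (x.1 : K) + (x.2.1 : K) * α + (x.2.2 : K) * β

/-- Evaluation is additive. [folklore] -/
theorem LF.eval_add (α β : K) (x y : LF) : LF.eval α β (x.add y) = x.eval α β + y.eval α β := by
  simp only [LF.eval, LF.add, Int.cast_add]; ring

/-- Evaluation of the negation. [folklore] -/
theorem LF.eval_neg (α β : K) (x : LF) : LF.eval α β x.neg = -(x.eval α β) := by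
  simp only [LF.eval, LF.neg, Int.cast_neg]; ring

/-- Evaluation of zero. [folklore] -/
@[simp] theorem LF.eval_zero (α β : K) : LF.eval α β ((0, 0, 0) : LF) = 0 := by
  simp [LF.eval]

/-- A model vector as an element of `K^{A ⊗ B}` (value of the code at `(codeA a, codeA b)`; note
both slots are coded by `3·(first index) + (second index)`). [folklore] -/
def MVec.toFun (α β : K) (v : MVec) : I9' × I9' → K := fun ab => (v.val (codeA ab.1) (codeA ab.2)).eval α β

/-! ## The test columns -/

/-- The `(210)` array with one slice: `y` at `x₀ = s₀`, zero elsewhere. [folklore] -/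
def arrI (s0 : I9') (y : I9' × I9' → K) : I9' × I9' × I9' → K :=
  fun x => if x.1 = s0 then y (x.2.1, x.2.2) else 0

/-- The `(120)` array with one slice: `y` at `x₂ = s₀`, zero elsewhere. [folklore] -/
def arrK (s0 : I9') (y : I9' × I9' → K) : I9' × I9' × I9' → K :=
  fun x => if x.2.2 = s0 then y (x.1, x.2.1) else 0

/-- The one-slice array lies in `A ⊗ E` when the slice lies in `E`. [folklore] -/
theorem arrI_mem_slicesI {E : Submodule K (I9' × I9' → K)} {y : I9' × I9' → K} (hy : y ∈ E) (s0 : I9') :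
    arrI s0 y ∈ slicesI E := by
  refine mem_slicesI.2 fun a₀ => ?_
  by_cases h : a₀ = s0
  · have : sliceI a₀ (arrI s0 y) = y := funext fun ab => by simp [arrI, h]
    rw [this]; exact hy
  · have : sliceI a₀ (arrI s0 y) = 0 := funext fun ab => by simp [arrI, h]
    rw [this]; exact Submodule.zero_mem _

/-- The one-slice array lies in `E ⊗ B` when the slice lies in `E`. [folklore] -/
theorem arrK_mem_slicesK {E : Submodule K (I9' × I9' → K)} {y : I9' × I9' → K} (hy : y ∈ E) (s0 : I9') :
    arrK s0 y ∈ slicesK E := by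
  refine mem_slicesK.2 fun b₁ => ?_
  by_cases h : b₁ = s0
  · have : sliceK b₁ (arrK s0 y) = y := funext fun ab => by simp [arrK, h]
    rw [this]; exact hy
  · have : sliceK b₁ (arrK s0 y) = 0 := funext fun ab => by simp [arrK, h]
    rw [this]; exact Submodule.zero_mem _

/-- **The `(210)` column `(s₀, v)`**: the skew-symmetrisation of the one-slice array.
[cite: ConnerHarperLandsberg2023, §3] -/
def colI (α β : K) (v : MVec) (s0 : I9') : I9' × I9' × I9' → K := skewIL (arrI s0 (v.toFun α β))

/-- **The `(120)` column `(s₀, v)`.** [cite: ConnerHarperLandsberg2023, §3] -/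
def colK (α β : K) (v : MVec) (s0 : I9') : I9' × I9' × I9' → K := skewKL (arrK s0 (v.toFun α β))

/-- The `(210)` column lies in `skewIL (A ⊗ E)` when `v ∈ E`. [folklore] -/
theorem colI_mem (α β : K) {E : Submodule K (I9' × I9' → K)} {v : MVec} (hv : v.toFun α β ∈ E) (s0 : I9') :
    colI α β v s0 ∈ (slicesI E).map (skewIL (K := K)) :=
  ⟨_, arrI_mem_slicesI hv s0, rfl⟩

/-- The `(120)` column lies in `skewKL (E ⊗ B)` when `v ∈ E`. [folklore] -/
theorem colK_mem (α β : K) {E : Submodule K (I9' × I9' → K)} {v : MVec} (hv : v.toFun α β ∈ E) (s0 : I9') :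
    colK α β v s0 ∈ (slicesK E).map (skewKL (K := K)) :=
  ⟨_, arrK_mem_slicesK hv s0, rfl⟩

/-- **Entries of the `(210)` column ARE `entryI`.** [folklore] -/
theorem colI_apply (α β : K) (v : MVec) (s0 : I9') (x : I9' × I9' × I9') :
    colI α β v s0 x = (entryI v (codeA s0) (codeA x.1) (codeA x.2.1) (codeA x.2.2)).eval α β := by
  simp only [colI, skewIL_apply, arrI, entryI, LF.eval_add, MVec.toFun,
    codeA_injective.eq_iff]
  split_ifs <;> simp [LF.eval_neg, sub_eq_add_neg]

/-- **Entries of the `(120)` column ARE `entryK`.** [folklore] -/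
theorem colK_apply (α β : K) (v : MVec) (s0 : I9') (x : I9' × I9' × I9') :
    colK α β v s0 x = (entryK v (codeA s0) (codeA x.1) (codeA x.2.1) (codeA x.2.2)).eval α β := by
  simp only [colK, skewKL_apply, arrK, entryK, LF.eval_add, MVec.toFun,
    codeA_injective.eq_iff]
  split_ifs <;> simp [LF.eval_neg, sub_eq_add_neg]

/-! ## Weights -/

/-- A model vector is WELL-FORMED: its block code is `< 9`. [folklore] -/
def MVec.wf : MVec → Prop
  | .unit jk _ _ => jk < 9
  | .diag jk _ => jk < 9

/-- The weight of a coordinate `(3i+r, 3i+t)` on a block diagonal does not depend on `i`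
(the slices are weight vectors; kernel-checked). [folklore] -/
theorem wt_diag_indep : ∀ i r t : Fin 3, wAN (3 * i + r) + wBN (3 * i + t) = wAN r + wBN t := by decide

/-- **A model vector is a weight vector of weight `MVec.wt`.** [cite: ConnerHarperLandsberg2023, §2.5] -/
theorem toFun_ne_zero (α β : K) {v : MVec} (hv : v.wf) {ab : I9' × I9'} (h : v.toFun α β ab ≠ 0) :
    wAN (codeA ab.1) + wBN (codeA ab.2) = v.wt := by
  cases v with
  | unit jk i i' =>
    simp only [MVec.toFun, MVec.val] at h
    split_ifs at h with hc
    · obtain ⟨h1, h2, h3, h4⟩ := hc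
      simp only [MVec.wt]
      have ea : codeA ab.1 = 3 * i + jk % 3 := by have := Nat.div_add_mod (codeA ab.1) 3; omega
      have eb : codeA ab.2 = 3 * i' + jk / 3 := by have := Nat.div_add_mod (codeA ab.2) 3; omega
      rw [ea, eb]
    · simp at h
  | diag jk d =>
    simp only [MVec.toFun, MVec.val] at h
    split_ifs at h with hc
    · obtain ⟨h1, h2, h3⟩ := hc
      simp only [MVec.wt]
      simp only [MVec.wf] at hv
      have hi : codeA ab.1 / 3 < 3 := by rw [codeA_div]; exact ab.1.1.isLt
      have hr : jk % 3 < 3 := Nat.mod_lt _ (by decide)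
      have ht : jk / 3 < 3 := by omega
      have ea : codeA ab.1 = 3 * (codeA ab.1 / 3) + jk % 3 := by
        have := Nat.div_add_mod (codeA ab.1) 3; omega
      have eb : codeA ab.2 = 3 * (codeA ab.1 / 3) + jk / 3 := by
        have := Nat.div_add_mod (codeA ab.2) 3; omega
      rw [ea, eb]
      exact wt_diag_indep ⟨_, hi⟩ ⟨_, hr⟩ ⟨_, ht⟩
    · simp at h

/-- **A `(210)` column is supported on the rows of its weight.** [folklore] -/
theorem colI_ne_zero (α β : K) {v : MVec} (hv : v.wf) (s0 : I9') {x : I9' × I9' × I9'}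
    (h : colI α β v s0 x ≠ 0) :
    rowWt false (codeA x.1, codeA x.2.1, codeA x.2.2) = colWt false v (codeA s0) := by
  simp only [colI, skewIL_apply, arrI] at h
  simp only [rowWt, colWt, if_false, Bool.false_eq_true]
  by_cases h1 : x.1 = s0
  · by_cases h2 : x.2.1 = s0
    · rw [h1, h2] at h; simp at h
    · rw [if_pos h1, if_neg h2, sub_zero] at h
      rw [← toFun_ne_zero α β hv h, h1]; ring
  · rw [if_neg h1, zero_sub, neg_ne_zero] at h
    split_ifs at h with h2
    · rw [← toFun_ne_zero α β hv h, h2]; simp only; ring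
    · exact absurd rfl h

/-- **A `(120)` column is supported on the rows of its weight.** [folklore] -/
theorem colK_ne_zero (α β : K) {v : MVec} (hv : v.wf) (s0 : I9') {x : I9' × I9' × I9'}
    (h : colK α β v s0 x ≠ 0) :
    rowWt true (codeA x.1, codeA x.2.1, codeA x.2.2) = colWt true v (codeA s0) := by
  simp only [colK, skewKL_apply, arrK] at h
  simp only [rowWt, colWt, if_true]
  by_cases h1 : x.2.2 = s0
  · by_cases h2 : x.2.1 = s0
    · rw [h1, h2] at h; simp at h
    · rw [if_pos h1, if_neg h2, sub_zero] at h
      rw [← toFun_ne_zero α β hv h, h1]; simp only; ring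
  · rw [if_neg h1, zero_sub, neg_ne_zero] at h
    split_ifs at h with h2
    · rw [← toFun_ne_zero α β hv h, h2]; simp only; ring
    · exact absurd rfl h

/-! ## The list determinant is the determinant -/

/-- Entries of `dropAt`. [folklore] -/
theorem getD_dropAt (r : List ℤ) (j t : ℕ) :
    (dropAt r j).getD t 0 = r.getD (if t < j then t else t + 1) 0 := by
  induction r generalizing j t with
  | nil => simp [dropAt]
  | cons a l ih =>
    cases j with
    | zero => simp [dropAt]
    | succ j =>
      cases t with
      | zero => simp [dropAt]
      | succ t =>
        simp only [dropAt, List.getD_cons_succ, ih]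
        by_cases h : t < j
        · rw [if_pos h, if_pos (by omega), List.getD_cons_succ]
        · rw [if_neg h, if_neg (by omega), List.getD_cons_succ]

/-- Length of `dropAt`. [folklore] -/
theorem length_dropAt (r : List ℤ) (j : ℕ) (hj : j < r.length) : (dropAt r j).length = r.length - 1 := by
  induction r generalizing j with
  | nil => simp at hj
  | cons a l ih =>
    cases j with
    | zero => simp [dropAt]
    | succ j =>
      simp only [List.length_cons] at hj
      simp only [dropAt, List.length_cons, ih j (by omega)]
      omega

/-- **`detL` is the determinant**: for a list of `n` rows of length `n` representing
`A : Matrix (Fin n) (Fin n) ℤ`, `detL n M = det A` (Laplace expansion along the first row).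
[folklore] -/
theorem detL_eq_det : ∀ (n : ℕ) (M : List (List ℤ)) (A : Matrix (Fin n) (Fin n) ℤ),
    M.length = n → (∀ r ∈ M, r.length = n) →
    (∀ (i j : Fin n), (M.getD i []).getD j 0 = A i j) → detL n M = A.det := by
  intro n
  induction n with
  | zero => intro M A _ _ _; simp [detL, Matrix.det_fin_zero]
  | succ n ih =>
    intro M A hlen hrows hA
    match M, hlen, hrows, hA with
    | row :: rows, hlen, hrows, hA =>
      have hrowlen : row.length = n + 1 := hrows row (by simp)
      rw [Matrix.det_succ_row_zero, detL, hrowlen]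
      rw [← List.sum_toFinset _ List.nodup_range, List.toFinset_range, Finset.sum_range]
      refine Finset.sum_congr rfl fun j _ => ?_
      have hrow : row.getD j 0 = A 0 j := by
        have := hA 0 j; simpa using this
      have hsign : (if (j : ℕ) % 2 = 0 then (1 : ℤ) else -1) = (-1) ^ (j : ℕ) := by
        rcases Nat.even_or_odd (j : ℕ) with he | ho
        · rw [if_pos (Nat.even_iff.1 he), he.neg_one_pow]
        · rw [if_neg (by rw [Nat.odd_iff.1 ho]; decide), ho.neg_one_pow]
      rw [hrow, hsign]
      congr 1
      refine ih _ _ (by simp only [List.length_map]; simp only [List.length_cons] at hlen; omega)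
        (fun r hr => ?_) (fun i t => ?_)
      · obtain ⟨r', hr', rfl⟩ := List.mem_map.1 hr
        have := hrows r' (by simp [hr'])
        rw [length_dropAt r' j (by rw [this]; exact j.isLt), this]
        rfl
      · have h1 : ((rows.map fun r => dropAt r j).getD i []) = dropAt (rows.getD i []) j := by
          rw [List.getD_eq_getElem?_getD, List.getElem?_map, List.getD_eq_getElem?_getD]
          cases h : rows[(i : ℕ)]? with
          | none => simp [dropAt]
          | some r => simp
        rw [h1, getD_dropAt]
        have := hA i.succ (Fin.succAbove j t)
        simp only [Fin.val_succ, List.getD_cons_succ] at this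
        rw [Matrix.submatrix_apply, ← this]
        congr 1
        unfold Fin.succAbove
        split_ifs with h h' h' <;> simp [Fin.lt_def] at h h' ⊢ <;> omega

end Ker

end MatMul3

end BorderApolarity

end Literature.Computability.AlgebraicComplexity

end
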